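import Literature.AlgebraicGeometry.Frobenioids.DivisorMonoidRightEqLeft
import Literature.AlgebraicGeometry.Frobenioids.DivisorMonoidTransportWeak
import Literature.AlgebraicGeometry.Frobenioids.PerfFactorialOrderIsoWeak
import Literature.AlgebraicGeometry.Frobenioids.Thm42SubWeak
import HarnessLib

/-!
# [FrdI] Thm. 4.9, p. 89: "the right-hand and left-hand isomorphisms of Theorem 4.2 (iii) coincide" — from the
# prime-local form to ONE isomorphism of monoids `Φ₁(A) ≅ Φ₂(Ψ A)`, WEAKLY perf-factorial divisor monoids

Mochizuki, *The geometry of Frobenioids I: the general theory*, Kyushu J. Math. **62** (2008)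
293–400, §4, proof of Theorem 4.9 (Kyushu text p. 370 ll. 8–33) [cite: MochizukiFrdI2008, Thm. 4.9 p.89]:
"… it suffices to show that the right-hand and left-hand isomorphisms of Theorem 4.2 (iii) coincide … Thus,
by allowing the `𝔭_i` to vary, we obtain … an isomorphism of monoids `Φ₁^pf(A₁)_factor ≅ Φ₂^pf(A₂)_factor` …
[which] maps the subset `Φ₁(A₁)` onto the subset `Φ₂(A₂)`".

PROOF-ONLY file (cell abc-iut, layer L1, seat abc-iut-L1-t14; row «C411iii/iv-WEAK» = the [FrdI] Thm. 4.9 /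
Cor. 4.11 (iii)(iv) chain over `IsPerfFactorialWeak`, block (T2)). WEAK-HYPOTHESIS TWINS of
`DivisorMonoidRightEqLeft.lean` (seat abc-iut-w4-d099) with "`Φ_i` perf-factorial" (Def. 2.4 (i) (a)–(d))
weakened to "`Φ_i` weakly perf-factorial" (`IsPerfFactorialWeak` = (a)(b)(c) + (d_ord) + (d_res); cell finding
F-L2d2-1): `eq_of_dvd_iff_of_forall_isPrimary_weak` (two divisibility-isomorphisms of perfect weakly
perf-factorial monoids which agree on primary elements agree — over seat abc-iut-L1-t11's
`IsPerfFactorialWeak.dvd_of_forall_isPrimary_dvd'` / `isPrimary_map_iff_of_dvd_iff_weak`,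
`PerfFactorialOrderIsoWeak.lean`), `PreFrobenioid.exists_mulEquiv_right_left_weak` (over
`PreFrobenioid.exists_mulEquiv_div_map_weak`, `DivisorMonoidTransportWeak.lean`), and the `T42.SettingWeak`-typed
`FrdI.T49.exists_mulEquiv_of_rightEqLeftAt_weak` / `…_family_weak`. The hypothesis-free left-hand transport
`PreFrobenioid.exists_invDivTransport` is consumed BY NAME. Proofs verbatim. No new definitions; nothing of the
paper restated or strengthened; nothing here is specific to the abc programme and no side is taken on
[IUTchIII] Cor. 3.12.
-/

namespace Literature.AlgebraicGeometry.Frobenioids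

open CategoryTheory Opposite

section Monoid

universe uM uN

variable {M : Type uM} [CommMonoid M] {N : Type uN} [CommMonoid N]

/-- (WEAK setting: `T42.SettingWeak`, weakly perf-factorial `Φ_i`; twin of the strong lemma of the same name without `_weak`.) **Two divisibility-isomorphisms of perfect perf-factorial monoids which agree on primary elements
agree**: an element is the least common multiple of its primary divisors (Def. 2.4 (i)(c)(d)).
[cite: MochizukiFrdI2008, Def. 2.4 (i) p.47] -/
theorem eq_of_dvd_iff_of_forall_isPrimary_weak (hM : IsPerfFactorialWeak M) (hN : IsPerfFactorialWeak N)
    (hMp : IsPerfect M) (hNp : IsPerfect N) (f g : M → N) (hf : Function.Bijective f)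
    (hg : Function.Bijective g) (hfd : ∀ x y : M, x ∣ y ↔ f x ∣ f y)
    (hgd : ∀ x y : M, x ∣ y ↔ g x ∣ g y) (hfg : ∀ p : M, IsPrimary p → f p = g p) (x : M) :
    f x = g x := by
  have key : ∀ f g : M → N, Function.Bijective f → (∀ x y : M, x ∣ y ↔ f x ∣ f y) →
      (∀ x y : M, x ∣ y ↔ g x ∣ g y) → (∀ p : M, IsPrimary p → f p = g p) → f x ∣ g x := by
    intro f g hf hfd hgd hfg
    refine hN.dvd_of_forall_isPrimary_dvd' hNp fun q hq hqx => ?_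
    obtain ⟨p, rfl⟩ := hf.2 q
    have hp : IsPrimary p := (isPrimary_map_iff_of_dvd_iff_weak hM hN hMp hNp f hf hfd p).mp hq
    rw [hfg p hp]
    exact (hgd p x).mp ((hfd p x).mpr hqx)
  haveI : IsCancelMul N := isIntegral_iff_isCancelMul.mp hN.isDivisorial.isPreDivisorial.isIntegral
  exact dvd_antisymm_of_isSharp hN.isDivisorial.isSharp (key f g hf hfd hgd hfg)
    (key g f hg hgd hfd fun p hp => (hfg p hp).symm)

end Monoid

namespace PreFrobenioid

universe w v v' u u'

variable {D₁ : Type u} [Category.{v} D₁] {Φ₁ : D₁ᵒᵖ ⥤ CommMonCat.{w}} {C₁ : Type u'} [Category.{v'} C₁]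
  {D₂ : Type u} [Category.{v} D₂] {Φ₂ : D₂ᵒᵖ ⥤ CommMonCat.{w}} {C₂ : Type u'} [Category.{v'} C₂]
  {F₁ : C₁ ⥤ ElemFrobenioid Φ₁} {F₂ : C₂ ⥤ ElemFrobenioid Φ₂}

/-- (WEAK setting: `T42.SettingWeak`, weakly perf-factorial `Φ_i`; twin of the strong lemma of the same name without `_weak`.) **"Right = left" at `A`, glued over the primes** (p. 89 ll. 8–33): for Frobenioids of perfect and
isotropic type with perf-factorial divisor monoids and `Ψ`, `Ψ⁻¹` preserving pre-steps, if every prime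
`𝔭` of `Φ₁(A)` carries an isomorphism of monoids `𝔭.submonoid ≃* 𝔭'.submonoid` onto some prime ray of
`Φ₂(Ψ A)` computing BOTH `Div(Ψ φ)` on the co-angular pre-steps `φ` out of `A` with `Div φ ∈ 𝔭` and
`(Ψψ)_*Div(Ψψ)` on the co-angular pre-steps `ψ` into `A` with `ψ_*Div ψ ∈ 𝔭` (the coincidence of the
right-hand and left-hand isomorphisms of Thm. 4.2 (iii) at `(A, 𝔭)`), then ONE isomorphism of monoids
`M : Φ₁(A) ≃* Φ₂(Ψ A)` computes `Div(Ψ φ) = M(Div φ)` for every pre-step `φ` out of `A` and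
`(Ψψ)^*(M y) = Div(Ψψ)` whenever `ψ^* y = Div ψ`, for every pre-step `ψ` into `A`.
[cite: MochizukiFrdI2008, Thm. 4.9 p.89] -/
theorem exists_mulEquiv_right_left_weak (Ψ : C₁ ≌ C₂) (hF₁ : IsFrobenioid F₁) (hF₂ : IsFrobenioid F₂)
    (hperf₁ : IsOfPerfectType F₁) (hperf₂ : IsOfPerfectType F₂)
    (histr₁ : IsOfIsotropicType F₁) (histr₂ : IsOfIsotropicType F₂)
    (hpf₁ : Objectwise (fun M _ => IsPerfFactorialWeak M) Φ₁)
    (hpf₂ : Objectwise (fun M _ => IsPerfFactorialWeak M) Φ₂)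
    (hpre : ∀ ⦃X Y : C₁⦄ (φ : X ⟶ Y), IsPreStep F₁ φ → IsPreStep F₂ (Ψ.functor.map φ))
    (hpre' : ∀ ⦃X Y : C₂⦄ (φ : X ⟶ Y), IsPreStep F₂ φ → IsPreStep F₁ (Ψ.inverse.map φ)) (A : C₁)
    (h : ∀ 𝔭 : Primes (Φ₁.obj (op (baseObj F₁ A))),
      ∃ (𝔭' : Primes (Φ₂.obj (op (baseObj F₂ (Ψ.functor.obj A)))))
        (m : 𝔭.submonoid ≃* 𝔭'.submonoid),
        (∀ ⦃B : C₁⦄ (φ : A ⟶ B), IsCoAngularPreStep F₁ φ → ∀ hφ : Div F₁ φ ∈ 𝔭.submonoid,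
            (m ⟨Div F₁ φ, hφ⟩ : Φ₂.obj (op (baseObj F₂ (Ψ.functor.obj A)))) =
              Div F₂ (Ψ.functor.map φ)) ∧
        ∀ ⦃B : C₁⦄ (ψ : B ⟶ A), IsCoAngularPreStep F₁ ψ →
          ∀ (y : Φ₁.obj (op (baseObj F₁ A))) (hy : y ∈ 𝔭.submonoid),
            pull Φ₁ (Base F₁ ψ) y = Div F₁ ψ →
              pull Φ₂ (Base F₂ (Ψ.functor.map ψ))
                  (m ⟨y, hy⟩ : Φ₂.obj (op (baseObj F₂ (Ψ.functor.obj A)))) =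
                Div F₂ (Ψ.functor.map ψ)) :
    ∃ M : Φ₁.obj (op (baseObj F₁ A)) ≃* Φ₂.obj (op (baseObj F₂ (Ψ.functor.obj A))),
      (∀ ⦃B : C₁⦄ (φ : A ⟶ B), IsPreStep F₁ φ → M (Div F₁ φ) = Div F₂ (Ψ.functor.map φ)) ∧
      ∀ ⦃B : C₁⦄ (ψ : B ⟶ A), IsPreStep F₁ ψ → ∀ y : Φ₁.obj (op (baseObj F₁ A)),
        pull Φ₁ (Base F₁ ψ) y = Div F₁ ψ →
          pull Φ₂ (Base F₂ (Ψ.functor.map ψ)) (M y) = Div F₂ (Ψ.functor.map ψ) := by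
  -- the right-hand transport, glued to a monoid isomorphism by the ray isomorphisms
  obtain ⟨M, hM⟩ := exists_mulEquiv_div_map_weak Ψ hF₁ hF₂ hperf₁ hperf₂ histr₁ histr₂ hpf₁ hpf₂ hpre
    hpre' A fun 𝔭 => by
      obtain ⟨𝔭', m, hr, -⟩ := h 𝔭
      exact ⟨𝔭', m, hr⟩
  -- the left-hand transport
  obtain ⟨L, hLb, hLd, hL⟩ := exists_invDivTransport Ψ hF₁ hF₂ histr₁ histr₂ hpre hpre' A
  have hMon : IsPerfFactorialWeak (Φ₁.obj (op (baseObj F₁ A))) := hpf₁ _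
  have hNon : IsPerfFactorialWeak (Φ₂.obj (op (baseObj F₂ (Ψ.functor.obj A)))) := hpf₂ _
  have hMp := isPerfect_divisorMonoid hF₁ hperf₁ A
  have hNp := isPerfect_divisorMonoid hF₂ hperf₂ (Ψ.functor.obj A)
  have hMd : ∀ x y : Φ₁.obj (op (baseObj F₁ A)), x ∣ y ↔ M x ∣ M y := fun x y =>
    ⟨fun hxy => map_dvd M hxy, fun hxy => by simpa using map_dvd M.symm hxy⟩
  -- `M = L` on primary elements: at the prime `𝔭 ∋ p`, both are computed by the ray isomorphism `m`
  have hprim : ∀ p : Φ₁.obj (op (baseObj F₁ A)), IsPrimary p → M p = L p := by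
    intro p hp
    -- `p = Div φ` (right) and `p = x_ψ` (left) for co-angular pre-steps `φ : A → B`, `ψ : B' → A`
    obtain ⟨B, φ, hφ, hφp⟩ := hF₁.iii_d_under_surj A p
    obtain ⟨B', ψ, hψ, hψp⟩ := hF₁.iii_d_over_surj A p
    let 𝔭 : Primes (Φ₁.obj (op (baseObj F₁ A))) :=
      Quotient.mk (primarySetoid (Φ₁.obj (op (baseObj F₁ A)))) ⟨p, hp⟩
    have hp𝔭 : p ∈ 𝔭.submonoid := (Primes.mem_submonoid_iff' 𝔭 p).mpr (Or.inr ⟨hp, rfl⟩)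
    obtain ⟨𝔭', m, hr, hl⟩ := h 𝔭
    haveI : IsIso (Base F₂ (Ψ.functor.map ψ)) := (hpre ψ hψ.2).2
    -- right: `M p = m p`
    have h1 : M p = (m ⟨p, hp𝔭⟩ : Φ₂.obj (op (baseObj F₂ (Ψ.functor.obj A)))) := by
      have hφp' : Div F₁ φ ∈ 𝔭.submonoid := hφp.symm ▸ hp𝔭
      have e1 : M p = M (Div F₁ φ) := by rw [hφp]
      have e2 : (⟨p, hp𝔭⟩ : 𝔭.submonoid) = ⟨Div F₁ φ, hφp'⟩ := Subtype.ext hφp.symm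
      rw [e1, hM φ hφ.2, e2, hr φ hφ hφp']
    -- left: `m p = x_{Ψψ} = L p`
    have h2 : (m ⟨p, hp𝔭⟩ : Φ₂.obj (op (baseObj F₂ (Ψ.functor.obj A)))) = L p := by
      have hpull : pull Φ₁ (Base F₁ ψ) p = Div F₁ ψ := by rw [← hψp, pull_invDiv]
      have h3 := hl ψ hψ p hp𝔭 hpull
      apply pull_injective_of_isIso Φ₂ (Base F₂ (Ψ.functor.map ψ))
      rw [h3, ← hψp, hL ψ hψ.2, pull_invDiv]
    exact h1.trans h2
  have hML : ∀ x, M x = L x := eq_of_dvd_iff_of_forall_isPrimary_weak hMon hNon hMp hNp M L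
    M.bijective hLb hMd hLd hprim
  refine ⟨M, hM, fun B ψ hψ y hy => ?_⟩
  haveI : IsIso (Base F₁ ψ) := hψ.2
  have hy' : y = invDiv F₁ ψ hψ.2 :=
    pull_injective_of_isIso Φ₁ (Base F₁ ψ) (by rw [hy, pull_invDiv])
  rw [hy', hML, hL ψ hψ, pull_invDiv]

end PreFrobenioid

namespace FrdI.T49

universe w v v' u u'

variable {D₁ : Type u} [Category.{v} D₁] {Φ₁ : D₁ᵒᵖ ⥤ CommMonCat.{w}} {C₁ : Type u'} [Category.{v'} C₁]
  {D₂ : Type u} [Category.{v} D₂] {Φ₂ : D₂ᵒᵖ ⥤ CommMonCat.{w}} {C₂ : Type u'} [Category.{v'} C₂]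
  {F₁ : C₁ ⥤ ElemFrobenioid Φ₁} {F₂ : C₂ ⥤ ElemFrobenioid Φ₂} {Ψ : C₁ ≌ C₂}

/-- (WEAK setting: `T42.SettingWeak`, weakly perf-factorial `Φ_i`; twin of the strong lemma of the same name without `_weak`.) **Global form of `RightEqLeftAt`** (p. 89 ll. 8–33): in a `T42.SettingWeak`, if every prime `𝔭` of
`Φ₁(A)` has a partner `𝔭'` with `RightEqLeftAt F₁ F₂ Ψ A 𝔭 𝔭'`, then ONE isomorphism of monoids
`M : Φ₁(A) ≃* Φ₂(Ψ A)` has the right-hand property on all pre-steps out of `A` and the left-hand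
property on all pre-steps into `A`. [cite: MochizukiFrdI2008, Thm. 4.9 p.89] -/
theorem exists_mulEquiv_of_rightEqLeftAt_weak (S : T42.SettingWeak F₁ F₂ Ψ) {A : C₁}
    (h : ∀ 𝔭 : Primes (Φ₁.obj (op (PreFrobenioid.baseObj F₁ A))),
      ∃ 𝔭' : Primes (Φ₂.obj (op (PreFrobenioid.baseObj F₂ (Ψ.functor.obj A)))),
        RightEqLeftAt F₁ F₂ Ψ A 𝔭 𝔭') :
    ∃ M : Φ₁.obj (op (PreFrobenioid.baseObj F₁ A)) ≃*
        Φ₂.obj (op (PreFrobenioid.baseObj F₂ (Ψ.functor.obj A))),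
      (∀ ⦃B : C₁⦄ (φ : A ⟶ B), PreFrobenioid.IsPreStep F₁ φ →
          M (PreFrobenioid.Div F₁ φ) = PreFrobenioid.Div F₂ (Ψ.functor.map φ)) ∧
      ∀ ⦃B : C₁⦄ (ψ : B ⟶ A), PreFrobenioid.IsPreStep F₁ ψ →
        ∀ y : Φ₁.obj (op (PreFrobenioid.baseObj F₁ A)),
          pull Φ₁ (PreFrobenioid.Base F₁ ψ) y = PreFrobenioid.Div F₁ ψ →
            pull Φ₂ (PreFrobenioid.Base F₂ (Ψ.functor.map ψ)) (M y) =
              PreFrobenioid.Div F₂ (Ψ.functor.map ψ) := by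
  refine PreFrobenioid.exists_mulEquiv_right_left_weak Ψ S.isFrobenioid₁ S.isFrobenioid₂ S.perfect₁
    S.perfect₂ S.isotropic₁ S.isotropic₂ S.perfFactorial₁ S.perfFactorial₂ S.preStep_map
    S.preStep_inv A fun 𝔭 => ?_
  obtain ⟨𝔭', m, hr, hl⟩ := h 𝔭
  exact ⟨𝔭', m, hr, hl⟩

/-- The same, consuming the family `e = Ψ^Prime` of `FrdI.T49.SufficesRightEqLeft`'s hypothesis at a
universally Div-Frobenius-trivial object. [cite: MochizukiFrdI2008, Thm. 4.9 p.89] -/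
theorem exists_mulEquiv_of_rightEqLeftAt_family_weak (S : T42.SettingWeak F₁ F₂ Ψ)
    (e : ∀ A : C₁, Primes (Φ₁.obj (op (PreFrobenioid.baseObj F₁ A))) ≃
      Primes (Φ₂.obj (op (PreFrobenioid.baseObj F₂ (Ψ.functor.obj A)))))
    (hRL : ∀ (A : C₁), PreFrobenioid.IsUniversallyDivFrobeniusTrivial F₁ A →
      ∀ 𝔭 : Primes (Φ₁.obj (op (PreFrobenioid.baseObj F₁ A))), RightEqLeftAt F₁ F₂ Ψ A 𝔭 (e A 𝔭))
    {A : C₁} (hA : PreFrobenioid.IsUniversallyDivFrobeniusTrivial F₁ A) :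
    ∃ M : Φ₁.obj (op (PreFrobenioid.baseObj F₁ A)) ≃*
        Φ₂.obj (op (PreFrobenioid.baseObj F₂ (Ψ.functor.obj A))),
      (∀ ⦃B : C₁⦄ (φ : A ⟶ B), PreFrobenioid.IsPreStep F₁ φ →
          M (PreFrobenioid.Div F₁ φ) = PreFrobenioid.Div F₂ (Ψ.functor.map φ)) ∧
      ∀ ⦃B : C₁⦄ (ψ : B ⟶ A), PreFrobenioid.IsPreStep F₁ ψ →
        ∀ y : Φ₁.obj (op (PreFrobenioid.baseObj F₁ A)),
          pull Φ₁ (PreFrobenioid.Base F₁ ψ) y = PreFrobenioid.Div F₁ ψ →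
            pull Φ₂ (PreFrobenioid.Base F₂ (Ψ.functor.map ψ)) (M y) =
              PreFrobenioid.Div F₂ (Ψ.functor.map ψ) :=
  exists_mulEquiv_of_rightEqLeftAt_weak S fun 𝔭 => ⟨e A 𝔭, hRL A hA 𝔭⟩

end FrdI.T49

end Literature.AlgebraicGeometry.Frobenioids
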